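import Summits.AtomisticToContinuum.Crystallization.Theorems.FrustratedLawDichotomyHalfSpaceColumnInfinite

/-!
# FrustratedLawDichotomy · crux `AperiodicFrustratedLawGap` (stmt-AtomisticToContinuum-27623) — the half-space ENERGY column (class-D side of the halo)
# (hdef side, row class H; companion of `…HalfSpaceColumn` (force); decomp-a2c, prover hand 1, gen 51)

A halo root next to a class-D region sees ARBITRARY `7/10`-separated matter beyond a plane at signed distance `d` (the D side), possibly denser
than its host.  Besides the force loads on its window (`…HalfSpaceColumn.sum_norm_force_le_of_separated_halfspace_sevenTenths`), its OWN pair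
energy with that matter needs a floor: `½Σ_{y beyond the plane} V_LJ(dist x y) ≥ −½·(1/6)·Σ (dist x y)⁻⁶`.  This file books that column from the
`p = 6` instance of `…HalfSpaceColumn.sum_rpow_neg_le_of_separated_halfspace`:

* `sum_inv_pow_six_le_of_separated_halfspace_sevenTenths` — `Σ_{a ∈ s} (dist x a)⁻¹^6 ≤ SH6(d)` for a finite `7/10`-separated `s` with `d ≤ ⟪a − x, e⟫`,
  `SH6(d) = 6·(6000/343)·(d⁻³/3 + (7/5 − d)d⁻⁴/4 + (49/100 − d²)d⁻⁵/5 + (7/10 − d)²·d·d⁻⁶/6)`;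
* `sum_abs_lennardJones_le_of_separated_halfspace_sevenTenths` — `Σ_{a ∈ s} |V_LJ(dist x a)| ≤ (1/6)·SH6(d)` for `d ≥ 1`;
* ★ `abs_tsum_lennardJones_le_of_halfspace_sevenTenths` — the same for an infinite `7/10`-separated `Y` (`tsum`; summability from
  `Literature…UniformlyDiscrete.summable_lennardJones_dist`);
* literal `halfSpaceEnergyColumn_seven_le : SH6(7) ≤ 11/500` (so the root-energy debit `(1/12)(SH6(7) − host half-space tail)` is `≤ 1.8·10⁻³`;
  desk FARCOL-HALO §13: with this column included the class-D boundary-atom tax at inner radius 7 stays `≤ 0.0135` on the binding F1 cell, `×1.09–1.7`).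

DEF-FREE; imports the tree's `…HalfSpaceColumnInfinite` only; 0 sorry (`|V_LJ| ≤ r⁻⁶/6` is re-derived inline as in `…FarFieldSharp`,
the landed `…LoopTunnelDialRangeTails.abs_lennardJones_le_of_one_le` having an incompatible import cone).  [folklore]
-/

noncomputable section

namespace Summit.AtomisticToContinuum.Crystallization.Theorems.FrustratedLawDichotomyHalfSpaceEnergyColumn

open scoped BigOperators RealInnerProductSpace
open Literature.MathematicalPhysics.StatisticalMechanics (lennardJones UniformlyDiscrete)
open Summit.AtomisticToContinuum.Crystallization.Theorems.FrustratedLawDichotomyHalfSpaceColumn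
  (sum_rpow_neg_le_of_separated_halfspace rpow_natCast_sub_natCast)

/-- **Half-space inverse-sixth-power column at separation `7/10`**: for a finite `7/10`-separated `s ⊂ ℝ³` with `d ≤ ⟪a − x, e⟫` for all `a ∈ s`
(`‖e‖ = 1`, `d ≥ 7/20`), `Σ_{a ∈ s} (dist x a)⁻¹^6 ≤ SH6(d)`. [folklore] -/
theorem sum_inv_pow_six_le_of_separated_halfspace_sevenTenths (s : Finset (EuclideanSpace ℝ (Fin 3)))
    (x e : EuclideanSpace ℝ (Fin 3)) (he : ‖e‖ = 1) {d : ℝ} (hd : 7 / 20 ≤ d)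
    (hsep : ∀ a ∈ s, ∀ b ∈ s, a ≠ b → (7 : ℝ) / 10 ≤ dist a b) (hhalf : ∀ a ∈ s, d ≤ ⟪a - x, e⟫) :
    ∑ a ∈ s, (dist x a)⁻¹ ^ 6 ≤
      6 * (6000 / 343) * (d⁻¹ ^ 3 / 3 + (7 / 5 - d) * d⁻¹ ^ 4 / 4 + (49 / 100 - d ^ 2) * d⁻¹ ^ 5 / 5 + (7 / 10 - d) ^ 2 * d * d⁻¹ ^ 6 / 6) := by
  have hd0 : 0 < d := by linarith
  have h6 := sum_rpow_neg_le_of_separated_halfspace s x e he (p := 6) (by norm_num : (0:ℝ) < 7 / 10) (by linarith) hd0 (by norm_num)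
    hsep hhalf
  have c6 : ∀ a ∈ s, (dist a x) ^ (-(6:ℝ)) = (dist x a)⁻¹ ^ 6 := fun a ha => by
    have hr : 0 < dist a x := hd0.trans_le (by
      have := hhalf a ha; have h2 : ⟪a - x, e⟫ ≤ ‖a - x‖ * ‖e‖ := real_inner_le_norm _ _
      rw [he, mul_one, ← dist_eq_norm] at h2; linarith)
    rw [dist_comm x a, show (-(6:ℝ)) = -((6:ℕ):ℝ) by norm_num, Real.rpow_neg hr.le, Real.rpow_natCast, inv_pow]
  have e33 : d ^ ((3:ℝ) - 6) = d⁻¹ ^ 3 := by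
    rw [show ((3:ℝ) - 6) = ((3:ℕ):ℝ) - ((6:ℕ):ℝ) by norm_num, rpow_natCast_sub_natCast hd0 (by norm_num)]
  have e24 : d ^ ((2:ℝ) - 6) = d⁻¹ ^ 4 := by
    rw [show ((2:ℝ) - 6) = ((2:ℕ):ℝ) - ((6:ℕ):ℝ) by norm_num, rpow_natCast_sub_natCast hd0 (by norm_num)]
  have e15 : d ^ ((1:ℝ) - 6) = d⁻¹ ^ 5 := by
    rw [show ((1:ℝ) - 6) = ((1:ℕ):ℝ) - ((6:ℕ):ℝ) by norm_num, rpow_natCast_sub_natCast hd0 (by norm_num)]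
  have e06 : d ^ (-(6:ℝ)) = d⁻¹ ^ 6 := by
    rw [show (-(6:ℝ)) = ((0:ℕ):ℝ) - ((6:ℕ):ℝ) by norm_num, rpow_natCast_sub_natCast hd0 (by norm_num)]
  rw [Finset.sum_congr rfl c6, e33, e24, e15, e06] at h6
  refine h6.trans (le_of_eq ?_)
  norm_num
  ring

/-- **Half-space ENERGY column, finite form**: for a finite `7/10`-separated `s` beyond the plane at signed distance `d ≥ 1` from `x`,
`Σ_{a ∈ s} |V_LJ(dist x a)| ≤ (1/6)·SH6(d)`. [folklore] -/
theorem sum_abs_lennardJones_le_of_separated_halfspace_sevenTenths (s : Finset (EuclideanSpace ℝ (Fin 3)))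
    (x e : EuclideanSpace ℝ (Fin 3)) (he : ‖e‖ = 1) {d : ℝ} (hd : 1 ≤ d)
    (hsep : ∀ a ∈ s, ∀ b ∈ s, a ≠ b → (7 : ℝ) / 10 ≤ dist a b) (hhalf : ∀ a ∈ s, d ≤ ⟪a - x, e⟫) :
    ∑ a ∈ s, |lennardJones (dist x a)| ≤
      1 / 6 * (6 * (6000 / 343) * (d⁻¹ ^ 3 / 3 + (7 / 5 - d) * d⁻¹ ^ 4 / 4 + (49 / 100 - d ^ 2) * d⁻¹ ^ 5 / 5 + (7 / 10 - d) ^ 2 * d * d⁻¹ ^ 6 / 6)) := by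
  have hfar : ∀ a ∈ s, d ≤ dist x a := fun a ha => by
    rw [dist_comm, dist_eq_norm]
    have h1 := hhalf a ha
    have h2 : ⟪a - x, e⟫ ≤ ‖a - x‖ * ‖e‖ := real_inner_le_norm _ _
    rw [he, mul_one] at h2
    linarith
  -- `|V_LJ(r)| ≤ r⁻⁶/6` for `r ≥ 1` (= `…LoopTunnelDialRangeTails.abs_lennardJones_le_of_one_le`, whose import cone is not compatible with
  -- `Literature…MuGroundStateConfiguration`; re-derived inline as in `…FarFieldSharp`)
  have hLJ : ∀ r : ℝ, 1 ≤ r → |lennardJones r| ≤ 1 / 6 * r⁻¹ ^ 6 := fun r hr => by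
    have hw0 : 0 ≤ r⁻¹ ^ 6 := by positivity
    have hw1 : r⁻¹ ^ 6 ≤ 1 := pow_le_one₀ (by positivity) (inv_le_one_of_one_le₀ hr)
    have h12 : r⁻¹ ^ 12 = r⁻¹ ^ 6 * r⁻¹ ^ 6 := by ring
    unfold lennardJones
    rw [abs_le]
    constructor
    · nlinarith [mul_nonneg hw0 hw0]
    · nlinarith [mul_le_mul_of_nonneg_left hw1 hw0]
  have hterm : ∀ a ∈ s, |lennardJones (dist x a)| ≤ 1 / 6 * (dist x a)⁻¹ ^ 6 :=
    fun a ha => hLJ _ (hd.trans (hfar a ha))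
  calc ∑ a ∈ s, |lennardJones (dist x a)| ≤ ∑ a ∈ s, 1 / 6 * (dist x a)⁻¹ ^ 6 := Finset.sum_le_sum hterm
    _ = 1 / 6 * ∑ a ∈ s, (dist x a)⁻¹ ^ 6 := by rw [Finset.mul_sum]
    _ ≤ _ := mul_le_mul_of_nonneg_left
        (sum_inv_pow_six_le_of_separated_halfspace_sevenTenths s x e he (by linarith) hsep hhalf) (by norm_num)

/-- ★ **Half-space ENERGY column, infinite form**: for a `7/10`-separated `Y ⊆ ℝ³` lying beyond the plane at signed distance `d ≥ 1` from `x` in the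
unit direction `e`, `|Σ'_{y ∈ Y} V_LJ(dist x y)| ≤ (1/6)·SH6(d)`; hence the root-energy debit of a class-D half-space at distance `d` is at most
`(1/12)·(SH6(d) − host half-space tail)`. [folklore] -/
theorem abs_tsum_lennardJones_le_of_halfspace_sevenTenths {Y : Set (EuclideanSpace ℝ (Fin 3))}
    (hsep : ∀ a ∈ Y, ∀ b ∈ Y, a ≠ b → (7 : ℝ) / 10 ≤ dist a b) (x e : EuclideanSpace ℝ (Fin 3)) (he : ‖e‖ = 1) {d : ℝ} (hd : 1 ≤ d)
    (hhalf : ∀ y ∈ Y, d ≤ ⟪y - x, e⟫) :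
    |∑' y : ↥Y, lennardJones (dist x y)| ≤
      1 / 6 * (6 * (6000 / 343) * (d⁻¹ ^ 3 / 3 + (7 / 5 - d) * d⁻¹ ^ 4 / 4 + (49 / 100 - d ^ 2) * d⁻¹ ^ 5 / 5 + (7 / 10 - d) ^ 2 * d * d⁻¹ ^ 6 / 6)) := by
  classical
  have hY : UniformlyDiscrete Y := ⟨7 / 10, by norm_num, hsep⟩
  have hsum : Summable fun y : ↥Y => lennardJones (dist x y) := hY.summable_lennardJones_dist x
  have habs : |∑' y : ↥Y, lennardJones (dist x y)| ≤ ∑' y : ↥Y, |lennardJones (dist x y)| := by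
    have h0 : Summable fun y : ↥Y => ‖lennardJones (dist x y)‖ := hsum.norm
    have := norm_tsum_le_tsum_norm h0
    simpa only [Real.norm_eq_abs] using this
  refine habs.trans (hsum.abs.tsum_le_of_sum_le fun u => ?_)
  set u' : Finset (EuclideanSpace ℝ (Fin 3)) := u.image Subtype.val with hu'
  have hmem : ∀ y ∈ u', y ∈ Y := fun y hy => by
    rw [hu', Finset.mem_image] at hy
    obtain ⟨w, -, rfl⟩ := hy
    exact w.2
  have hsum_eq : ∑ y ∈ u, |lennardJones (dist x y)| = ∑ y ∈ u', |lennardJones (dist x y)| := by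
    rw [hu', Finset.sum_image (fun a _ b _ h => Subtype.ext h)]
  rw [hsum_eq]
  exact sum_abs_lennardJones_le_of_separated_halfspace_sevenTenths u' x e he hd
    (fun a ha b hb hab => hsep a (hmem a ha) b (hmem b hb) hab) fun y hy => hhalf y (hmem y hy)

/-- `SH6(7) ≤ 11/500 = 2.2·10⁻²`, i.e. the class-D half-space at distance `7` costs the root at most `(1/12)·SH6(7) ≤ 1.84·10⁻³` before the host's own
half-space tail is credited (`≈ 1.47·10⁻³` net on F1). [folklore] -/
theorem halfSpaceEnergyColumn_seven_le :
    6 * (6000 / 343) * ((7:ℝ)⁻¹ ^ 3 / 3 + (7 / 5 - 7) * (7:ℝ)⁻¹ ^ 4 / 4 + (49 / 100 - 7 ^ 2) * (7:ℝ)⁻¹ ^ 5 / 5 + (7 / 10 - 7) ^ 2 * 7 * (7:ℝ)⁻¹ ^ 6 / 6) ≤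
      11 / 500 := by
  norm_num

end Summit.AtomisticToContinuum.Crystallization.Theorems.FrustratedLawDichotomyHalfSpaceEnergyColumn

end
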